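import Summits.ResolutionOfSingularities.ResolutionOfSingularities.Theorems.LassoCutClasses
import HarnessLib

/-!
# LassoCutAxisTails — the decided cell of the node «LassoCut»: NO AXIS TAILS, hence no one-chart corner lassos (§4)
(decomp-res node N57, lens-5 g13 sha256 a9bc663c66df87f5; CRITIC-LEDGER row 78 CLEARED; file 3 of 4, namespace
`…Theorems.LassoCut` continued.)

An infinite forced walk cannot have an eventually constant CORNER recipe `(j_t, b_t) = (j, 0)` (`no_axis_tail`): the
off-chart degree `|m| − m_j` of a monomial is invariant under the `u_j`-chart exponent law, a monomial with off-chart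
degree `< q` loses total degree at every such step while orders stay `≥ q`, and a polynomial all of whose monomials have
off-chart degree `≥ q` has its top ideal inside the AXIS ideal, contradicting `IsolatedTop`
(`not_isolatedTop_of_offHeavy`).  Hence `no_cornerMonoChart_lasso`: the first DECIDED cell of `NoLassos` (PROVED, no port,
no item).  (Sources: Hauser2010 §§F–G; Moh1987.)
-/

open MvPolynomial
open Literature.AlgebraicGeometry.Resolution
open Literature.AlgebraicGeometry.Resolution.Hauser2010
open Literature.AlgebraicGeometry.Resolution.PointBlowup
open Summit.ResolutionOfSingularities.ResolutionOfSingularities.Theorems.TightDefectClasses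
open Summit.ResolutionOfSingularities.ResolutionOfSingularities.Theorems.WeakOrderReduction
open Summit.ResolutionOfSingularities.ResolutionOfSingularities.Theorems.ForcedTowerClasses

namespace Summit.ResolutionOfSingularities.ResolutionOfSingularities.Theorems.LassoCut

/-! ## §4 A decided cell: NO AXIS TAILS (eventually constant corner recipe), hence no one-chart corner lassos -/

section AxisTails

variable {K : Type} [Field K] [DecidableEq K]

/-- The OFF-CHART DEGREE `|m| − m_j` of every monomial is at least `q`. DEFINITION (support). -/
def OffHeavy (q : ℕ) (j : Fin 3) (F : MvPolynomial (Fin 3) K) : Prop :=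
  ∀ m ∈ F.support, q ≤ m.degree - m j

omit [DecidableEq K] in
/-- Coefficient formula for Hasse derivatives (linear extension of the tree's `coeff_hasseDeriv_monomial`; verbatim
lens-5 g11). (Sources: EGAIV4, Thm. 16.11.2.) -/
theorem coeff_hasseDeriv_eq (α β : Fin 3 →₀ ℕ) (F : MvPolynomial (Fin 3) K) :
    coeff β (hasseDeriv K α F) = ((∏ i ∈ α.support, ((α + β) i).choose (α i) : ℕ) : K) * coeff (α + β) F := by
  classical
  induction F using MvPolynomial.induction_on' with
  | monomial δ c =>
    rw [coeff_hasseDeriv_monomial, coeff_monomial]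
    by_cases h : δ = α + β
    · subst h; rw [if_pos rfl, if_pos rfl]
    · rw [if_neg h, if_neg h, mul_zero]
  | add p q hp hq => rw [map_add, coeff_add, coeff_add, hp, hq, mul_add]

omit [DecidableEq K] in
/-- `|d| = d_j + Σ_{i ≠ j} d_i` in three indices, as an inequality usable by `omega`: `d_j ≤ |d|` and the off-chart
degree is additive. [folklore] -/
theorem degree_sub_apply_add (j : Fin 3) (α β : Fin 3 →₀ ℕ) :
    (α + β).degree - (α + β) j = (α.degree - α j) + (β.degree - β j) := by
  have hα := degree_eq_add_sum_erase j α
  have hβ := degree_eq_add_sum_erase j β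
  rw [map_add, Finsupp.add_apply]
  omega

omit [DecidableEq K] in
/-- The top ideal of an off-heavy polynomial lies in the AXIS IDEAL `(u_i : i ≠ j)`. [folklore] -/
theorem topIdeal_le_axis_of_offHeavy {q : ℕ} {j : Fin 3} {F : MvPolynomial (Fin 3) K} (hF : OffHeavy q j F) :
    topIdeal q F ≤ Ideal.span (MvPolynomial.X '' {i : Fin 3 | i ≠ j} : Set (MvPolynomial (Fin 3) K)) := by
  classical
  refine Ideal.span_le.mpr ?_
  rintro _ ⟨α, ⟨hα0, hαq⟩, rfl⟩
  rw [SetLike.mem_coe, MvPolynomial.mem_ideal_span_X_image]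
  intro m hm
  rw [MvPolynomial.mem_support_iff, coeff_hasseDeriv_eq] at hm
  have hαm : coeff (α + m) F ≠ 0 := fun h => hm (by rw [h, mul_zero])
  have hmem : α + m ∈ F.support := MvPolynomial.mem_support_iff.mpr hαm
  have h1 := hF _ hmem
  rw [degree_sub_apply_add] at h1
  have h2 : α.degree - α j < q := lt_of_le_of_lt (Nat.sub_le _ _) hαq
  have h3 : 0 < m.degree - m j := by omega
  have hm' := degree_eq_add_sum_erase j m
  have h4 : 0 < ∑ i ∈ Finset.univ.erase j, m i := by omega
  obtain ⟨i, hi, hne⟩ := Finset.exists_ne_zero_of_sum_ne_zero h4.ne'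
  exact ⟨i, (Finset.ne_of_mem_erase hi : i ≠ j), hne⟩

omit [DecidableEq K] in
/-- **An OFF-HEAVY polynomial is NOT an isolated top point**: the top locus contains the `u_j`-axis (an isolation
witness `g·u_j^N ∈ J_F ⊆ (u_i : i ≠ j)` would put the pure power `u_j^N`, coefficient `g(0) ≠ 0`, into the axis ideal).
[folklore] -/
theorem not_isolatedTop_of_offHeavy {q : ℕ} {j : Fin 3} {F : MvPolynomial (Fin 3) K} (hF : OffHeavy q j F) :
    ¬ IsolatedTop q F := by
  classical
  rintro ⟨N, g, hg0, hg⟩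
  have hmem := topIdeal_le_axis_of_offHeavy hF (hg j)
  rw [MvPolynomial.mem_ideal_span_X_image] at hmem
  have hg0' : coeff 0 g ≠ 0 := hg0
  have hsupp : Finsupp.single j N ∈ (g * X j ^ N).support := by
    rw [MvPolynomial.mem_support_iff, MvPolynomial.X_pow_eq_monomial, MvPolynomial.coeff_mul_monomial',
      if_pos le_rfl, tsub_self, mul_one]
    exact hg0'
  obtain ⟨i, hi, hne⟩ := hmem _ hsupp
  have hij : i ≠ j := hi
  exact hne (by rw [Finsupp.single_apply, if_neg (Ne.symm hij)])

/-! ### The corner-step calculus on monomials -/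

/-- After any step the monomials of degree `< q` are gone (equimultiplicity kills `0 < |m| < q`, cleaning kills the
constant). (Sources: Hauser2010, §F.) -/
theorem coeff_st_succ_eq_zero {q : ℕ} {s₀ : State (Fin 3) K} (W : ForcedWalk q s₀) (t : ℕ) {m : Fin 3 →₀ ℕ}
    (hm : m.degree < q) : coeff m (W.st (t + 1)).F = 0 := by
  classical
  rw [W.st_succ t]
  change coeff m (deletePthPowers q (pointTransform q (W.j t) (W.b t) (W.st t))) = 0
  rw [coeff_deletePthPowers]
  split_ifs with h
  · rfl
  · by_cases hm0 : m = 0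
    · exfalso
      apply h
      subst hm0
      intro i hi
      simp at hi
    · exact W.equimult t m hm0 hm

/-- … so every monomial after a step has degree `≥ q`. (Sources: Hauser2010, §F.) -/
theorem le_degree_of_mem_support_succ {q : ℕ} {s₀ : State (Fin 3) K} (W : ForcedWalk q s₀) (t : ℕ)
    {m : Fin 3 →₀ ℕ} (hm : m ∈ (W.st (t + 1)).F.support) : q ≤ m.degree := by
  by_contra h
  exact (MvPolynomial.mem_support_iff.mp hm) (coeff_st_succ_eq_zero W t (not_le.mp h))

/-- … and none of them is a `q`-th power exponent (the state is cleaned). (Sources: Hauser2010, §F.) -/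
theorem not_isPthPowerExponent_of_mem_support_succ {q : ℕ} {s₀ : State (Fin 3) K} (W : ForcedWalk q s₀) (t : ℕ)
    {m : Fin 3 →₀ ℕ} (hm : m ∈ (W.st (t + 1)).F.support) : ¬ IsPthPowerExponent q m := by
  classical
  intro hP
  rw [W.st_succ t, MvPolynomial.mem_support_iff] at hm
  apply hm
  change coeff m (deletePthPowers q (pointTransform q (W.j t) (W.b t) (W.st t))) = 0
  rw [coeff_deletePthPowers, if_pos hP]

/-- The OFF-CHART DEGREE is invariant under the `u_j`-chart exponent law. [folklore] -/
theorem offDegree_chartExponent (q : ℕ) (j : Fin 3) (m : Fin 3 →₀ ℕ) :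
    (chartExponent q j m).degree - chartExponent q j m j = m.degree - m j := by
  rw [degree_chartExponent, chartExponent_apply, if_pos rfl]
  have := degree_eq_add_sum_erase j m
  omega

/-- A LOW monomial (off-chart degree `< q`) loses total degree under the `u_j`-chart exponent law. [folklore] -/
theorem degree_chartExponent_lt {q : ℕ} {j : Fin 3} {m : Fin 3 →₀ ℕ} (hq : q ≤ m.degree)
    (hlow : m.degree - m j < q) : (chartExponent q j m).degree < m.degree := by
  rw [degree_chartExponent]
  have := degree_eq_add_sum_erase j m
  omega

/-- A low cleaned monomial of degree `≥ q` stays a NON-`q`-th-power exponent under the chart law (so cleaning does not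
delete it). [folklore] -/
theorem not_isPthPowerExponent_chartExponent {q : ℕ} {j : Fin 3} {m : Fin 3 →₀ ℕ} (hq : q ≤ m.degree)
    (hm : ¬ IsPthPowerExponent q m) (hlow : m.degree - m j < q) :
    ¬ IsPthPowerExponent q (chartExponent q j m) := by
  classical
  intro hP
  apply hm
  have hsum := degree_eq_add_sum_erase j m
  -- either some off-chart exponent is positive (then `q ∣ m_i` with `0 < m_i < q`: absurd) or `m` is a pure `u_j`-power
  by_cases hex : ∃ i, i ≠ j ∧ m i ≠ 0
  · exfalso
    obtain ⟨i, hij, hi⟩ := hex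
    have hmem : i ∈ (chartExponent q j m).support := by
      rw [Finsupp.mem_support_iff, chartExponent_apply, if_neg hij]
      exact hi
    have hdvd := hP i hmem
    rw [chartExponent_apply, if_neg hij] at hdvd
    have hle : m i ≤ m.degree - m j := apply_le_degree_sub hij m
    have hlt : m i < q := lt_of_le_of_lt hle hlow
    exact absurd (Nat.le_of_dvd (Nat.pos_of_ne_zero hi) hdvd) (not_le.mpr hlt)
  · push Not at hex
    have hzero : ∑ i ∈ Finset.univ.erase j, m i = 0 :=
      Finset.sum_eq_zero fun i hi => hex i (Finset.ne_of_mem_erase hi)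
    have hdeg : m.degree = m j := by omega
    intro i hi
    by_cases hij : i = j
    · subst hij
      by_cases hmq : m i - q = 0
      · have : m i = q := by
          have := Finsupp.mem_support_iff.mp hi
          omega
        rw [this]
      · have hmem : i ∈ (chartExponent q i m).support := by
          rw [Finsupp.mem_support_iff, chartExponent_apply, if_pos rfl, hdeg]
          exact hmq
        have hdvd := hP i hmem
        rw [chartExponent_apply, if_pos rfl, hdeg] at hdvd
        have : m i = (m i - q) + q := by omega
        rw [this]
        exact dvd_add hdvd dvd_rfl
    · exact absurd (hex i hij) (Finsupp.mem_support_iff.mp hi)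

/-- **One CORNER step in the chart `u_j` transports every low monomial** (chart law, no translation, survives the
cleaning) to a low monomial of smaller degree. (Sources: Hauser2010, §F.) -/
theorem low_monomial_transport {q : ℕ} {s₀ : State (Fin 3) K} (W : ForcedWalk q s₀) {j : Fin 3} {t : ℕ}
    (hj : W.j (t + 1) = j) (hb : W.b (t + 1) = 0) {m : Fin 3 →₀ ℕ} (hm : m ∈ (W.st (t + 1)).F.support)
    (hlow : m.degree - m j < q) :
    chartExponent q j m ∈ (W.st (t + 1 + 1)).F.support ∧
      (chartExponent q j m).degree - chartExponent q j m j < q ∧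
      (chartExponent q j m).degree < m.degree := by
  classical
  have hq : q ≤ m.degree := le_degree_of_mem_support_succ W t hm
  have hall : ∀ d ∈ (W.st (t + 1)).F.support, q ≤ d.degree := fun d hd => le_degree_of_mem_support_succ W t hd
  have hnot : ¬ IsPthPowerExponent q (chartExponent q j m) :=
    not_isPthPowerExponent_chartExponent hq (not_isPthPowerExponent_of_mem_support_succ W t hm) hlow
  refine ⟨?_, by rw [offDegree_chartExponent q j m]; exact hlow, degree_chartExponent_lt hq hlow⟩
  rw [MvPolynomial.mem_support_iff, W.st_succ (t + 1)]
  change coeff (chartExponent q j m)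
    (deletePthPowers q (translate (W.b (t + 1)) (chartTransform q (W.j (t + 1)) (W.st (t + 1)).F))) ≠ 0
  rw [hb, hj, PointBlowup.translate_zero, coeff_deletePthPowers, if_neg hnot,
    HauserPerlega2024.coeff_chartExponent_chartTransform q j hall hm]
  exact MvPolynomial.mem_support_iff.mp hm

/-- **NO AXIS TAILS** (DECIDED, every `q`, every field): an infinite forced walk cannot have an eventually constant
CORNER recipe `(j_t, b_t) = (j, 0)` for `t ≥ t₀ + 1` — it would hug the `u_j`-AXIS through corner points: low monomials
descend in degree until the order drops below `q` (impossible after a step), so every monomial is off-heavy and the top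
locus contains the axis, contradicting isolation. [DECIDED — PROVED here] (Sources: Hauser2010, §F.) -/
theorem no_axis_tail {q : ℕ} {s₀ : State (Fin 3) K} (W : ForcedWalk q s₀) (j : Fin 3) (t₀ : ℕ)
    (hrec : ∀ t, t₀ ≤ t → W.j (t + 1) = j ∧ W.b (t + 1) = 0) : False := by
  classical
  -- descent: a low monomial at a time `t + 1`, `t ≥ t₀`, has arbitrarily large degree — absurd
  have descent : ∀ n : ℕ, ∀ t, t₀ ≤ t → ∀ m ∈ (W.st (t + 1)).F.support, m.degree - m j < q → n ≤ m.degree := by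
    intro n
    induction n with
    | zero => intros; exact Nat.zero_le _
    | succ n ih =>
      intro t ht m hm hlow
      obtain ⟨hj, hb⟩ := hrec t ht
      obtain ⟨hmem, hlow', hlt⟩ := low_monomial_transport W hj hb hm hlow
      have := ih (t + 1) (by omega) _ hmem hlow'
      omega
  have hheavy : OffHeavy q j (W.st (t₀ + 1)).F := by
    intro m hm
    by_contra hlow
    have := descent (m.degree + 1) t₀ le_rfl m hm (not_le.mp hlow)
    omega
  exact not_isolatedTop_of_offHeavy hheavy (W.isolated (t₀ + 1))

/-- Inside the pumped walk, walk times `≥ t₀` read cycle indices `≥ t₀`. [folklore] -/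
theorem Lasso.le_clock {q : ℕ} {s₀ : State (Fin 3) K} (L : Lasso q s₀) {t : ℕ} (ht : L.t₀ ≤ t) : L.t₀ ≤ L.clock t := by
  induction t with
  | zero =>
    have : L.t₀ = 0 := by omega
    rw [this]
    exact Nat.zero_le _
  | succ t ih =>
    rw [Lasso.clock_succ]
    split_ifs with h
    · exact le_rfl
    · by_cases ht' : L.t₀ ≤ t
      · exact le_trans (ih ht') (Nat.le_succ _)
      · have h1 : t + 1 = L.t₀ := by omega
        have hlt := L.lt
        have h2 : L.clock t = t := L.clock_eq_self (by omega)
        rw [h2]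
        omega

/-- **The decided cell of `NoLassos`: no ONE-CHART CORNER lasso** (every cycle step in the same chart `u_j` at the
corner point `b = 0`; in particular no lasso of period one at a corner point) — any `q`, any field.
[DECIDED — PROVED here, by pumping + `no_axis_tail`] (Sources: Hauser2010, §F.) -/
theorem no_cornerMonoChart_lasso {q : ℕ} {s₀ : State (Fin 3) K} (L : Lasso q s₀) (j : Fin 3)
    (h : ∀ c, L.t₀ ≤ c → c < L.t₁ → L.run.j c = j ∧ L.run.b c = 0) : False := by
  refine no_axis_tail L.pump j L.t₀ fun t ht => ?_
  have hc := L.le_clock (show L.t₀ ≤ t + 1 by omega)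
  exact h _ hc (L.clock_lt (t + 1))

end AxisTails

end Summit.ResolutionOfSingularities.ResolutionOfSingularities.Theorems.LassoCut
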